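import Literature.NumberTheory.NumberFields.ClassGroupCert
import Literature.NumberTheory.NumberFields.CubicFieldDedekindKummer
import HarnessLib

/-!
# Class group certificates for cubic fields via Dedekind–Kummer

Glue between `ClassGroupCert.lean` (relations `ClassIn H P` from norms, Minkowski generation) and
`CubicFieldDedekindKummer.lean` (primes of `𝓞 K` above `p` from roots of the cubic modulo `p`, for
`ℤ[θ] ⊆ 𝓞 K` of index prime to `p`), in the form consumed by machine-generated certificate
tables: primes above a prime `p` modulo which the cubic splits into given linear factors
(`eq_span_pair_of_splits`, with `N(P) = p`), membership of `x + yθ + zθ²` in `(p, θ - r)`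
(`mem_span_pair_of_eval`), the discharge of the side condition of `ClassIn.of_mem_of_absNorm`
from the rational primes dividing `m` (`classIn_of_absNorm_dvd`), inert primes
(`classIn_of_no_root`), one certificate step (`classIn_of_cert`), the `3`-torsion subgroup
`ker3` and order-`3` certificates (`mk0_pow_three_eq_one_of_cert`), and the conclusion
`Odd h_K` (`odd_classNumber_of_ker3_eq_top`). Theorems only (plus the abbreviation `ker3`).
[cite: Marcus2018, Ch. 3, Thm. 27; Ch. 5, Thm. 35–37]

## References

* D. A. Marcus, *Number Fields*, 2nd ed. (2018), Ch. 3 Thm. 27, Ch. 5 Thm. 35–37 and the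
  class-number computations following Cor. 2 of Thm. 35. [cite: Marcus2018, Ch. 5, Thm. 35]
-/

noncomputable section

open scoped NumberField

open NumberField Module Polynomial Ideal
open scoped nonZeroDivisors

namespace Literature.NumberTheory.NumberFields

namespace MonicCubic

variable {K : Type*} [Field K] [NumberField K] {a b c : ℤ} {θ : K}

/-! ### Primes above a prime modulo which the cubic splits into linear factors -/

/-- **Primes above `p` when `f ≡ (X - r₁)(X - r₂)(X - r₃) (mod p)`** (`p ∤ [𝓞 K : ℤ[θ]]`): every
`P ∣ p` is `(p, θ - rᵢ)` for some `i`, and `N(P) = p`. (Covers totally split and totally ramified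
`p`.) [cite: Marcus2018, Ch. 3, Thm. 27] -/
theorem eq_span_pair_of_splits (hirr : Irreducible (polyQ a b c))
    (hθ : aeval θ (poly a b c) = 0) {p : ℕ} (hp : p.Prime)
    (hexp : ¬ p ∣ RingOfIntegers.exponent (thetaInt hθ)) (r₁ r₂ r₃ : ℤ)
    (hsplit : polyMod a b c p =
      (X - C (r₁ : ZMod p)) * (X - C (r₂ : ZMod p)) * (X - C (r₃ : ZMod p)))
    {P : Ideal (𝓞 K)} (hP : P ∈ primesOver (span {(p : ℤ)}) (𝓞 K)) :
    (∃ r ∈ [r₁, r₂, r₃], P = span {(p : 𝓞 K), thetaInt hθ - (r : 𝓞 K)}) ∧ absNorm P = p := by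
  haveI := Fact.mk hp
  obtain ⟨Qb, hirr', hmon, hdvd, hdeg, hspan⟩ := exists_factor_of_mem_primesOver' hirr hθ hp hexp hP
  have hprime : Prime Qb := hirr'.prime
  rw [hsplit] at hdvd
  have hlin : ∀ r : ℤ, Qb ∣ X - C (r : ZMod p) → Qb = X - C (r : ZMod p) := fun r h =>
    eq_of_monic_of_associated hmon (monic_X_sub_C _) (hirr'.associated_of_dvd (irreducible_X_sub_C _) h)
  have hQb : ∃ r ∈ [r₁, r₂, r₃], Qb = X - C (r : ZMod p) := by
    rcases hprime.dvd_or_dvd hdvd with h | h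
    · rcases hprime.dvd_or_dvd h with h | h
      · exact ⟨r₁, by simp, hlin r₁ h⟩
      · exact ⟨r₂, by simp, hlin r₂ h⟩
    · exact ⟨r₃, by simp, hlin r₃ h⟩
  obtain ⟨r, hr, hQbr⟩ := hQb
  refine ⟨⟨r, hr, ?_⟩, ?_⟩
  · have h := hspan (X - C r) (by rw [hQbr]; simp)
    simpa using h
  · haveI := hP.1
    haveI := hP.2
    have h := Ideal.pow_inertiaDeg p P
    rw [hdeg, hQbr, natDegree_X_sub_C, pow_one] at h
    exact h.symm

/-- **Membership in `(p, θ - r)`**: `x + yθ + zθ² ∈ (p, θ - r)` when `p ∣ x + yr + zr²`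
(`x + yθ + zθ² = pk + (θ - r)(y + z(θ + r))`). [folklore] -/
theorem mem_span_pair_of_eval (hθ : aeval θ (poly a b c) = 0) {p : ℕ} {r x y z k : ℤ}
    (hk : x + y * r + z * r ^ 2 = p * k) :
    ((x : 𝓞 K) + y * thetaInt hθ + z * thetaInt hθ ^ 2) ∈
      span {(p : 𝓞 K), thetaInt hθ - (r : 𝓞 K)} := by
  rw [Ideal.mem_span_pair]
  refine ⟨k, y + z * (thetaInt hθ + r), ?_⟩
  have hk' : ((x : ℤ) : 𝓞 K) + y * r + z * r ^ 2 = (p : 𝓞 K) * k := by exact_mod_cast congrArg (Int.cast (R := 𝓞 K)) hk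
  linear_combination -hk'

omit [NumberField K] in
/-- **A prime above `p` from `p ∈ Q`.** [folklore] -/
theorem mem_primesOver_of_mem {Q : Ideal (𝓞 K)} (hQ : Q.IsPrime) {p : ℕ}
    (hp : p.Prime) (hpQ : (p : 𝓞 K) ∈ Q) : Q ∈ primesOver (span {(p : ℤ)}) (𝓞 K) := by
  refine ⟨hQ, ⟨?_⟩⟩
  have hmax : (span {(p : ℤ)}).IsMaximal :=
    ((span_singleton_prime (by exact_mod_cast hp.ne_zero)).mpr
      (Nat.prime_iff_prime_int.mp hp)).isMaximal (by
        rw [Ne, span_singleton_eq_bot]; exact_mod_cast hp.ne_zero)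
  refine (hmax.eq_of_le (hQ.under ℤ).ne_top ?_)
  rw [span_singleton_le_iff_mem, under_def, mem_comap]
  simpa using hpQ

/-- **Discharging the side condition of `ClassIn.of_mem_of_absNorm` prime by prime**: if for every
rational prime `q ∣ m` all primes above `q` have `ClassIn H`, then so does every non-zero prime
`Q` with `N(Q) ∣ m`. [folklore] -/
theorem classIn_of_absNorm_dvd {H : Subgroup (ClassGroup (𝓞 K))} {m : ℕ}
    (hm : ∀ q : ℕ, q.Prime → q ∣ m → ∀ Q ∈ primesOver (span {(q : ℤ)}) (𝓞 K), ClassIn H Q)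
    (Q : Ideal (𝓞 K)) (hQ : Q.IsPrime) (hQ0 : Q ≠ ⊥) (hdvd : absNorm Q ∣ m) : ClassIn H Q := by
  -- the rational prime under `Q`
  obtain ⟨q, hq, hqQ⟩ : ∃ q : ℕ, q.Prime ∧ (q : 𝓞 K) ∈ Q := by
    obtain ⟨p, hp⟩ := IsPrincipalIdealRing.principal <| under ℤ Q
    have hp0 : p ≠ 0 := fun h' => hQ0 <| eq_bot_of_comap_eq_bot (R := ℤ) <| by
      simpa only [hp, submodule_span_eq, span_singleton_eq_bot]
    have hpprime := (span_singleton_prime hp0).mp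
    simp only [← submodule_span_eq, ← hp] at hpprime
    have hpmem : (p : 𝓞 K) ∈ Q := by
      have : p ∈ under ℤ Q := by rw [hp]; exact mem_span_singleton_self p
      simpa [under_def, mem_comap] using this
    refine ⟨p.natAbs, Int.prime_iff_natAbs_prime.mp (hpprime (hQ.under _)), ?_⟩
    have e : ((p.natAbs : ℕ) : 𝓞 K) = (p : 𝓞 K) ∨ ((p.natAbs : ℕ) : 𝓞 K) = -(p : 𝓞 K) := by
      rcases Int.natAbs_eq p with h' | h'
      · left; conv_rhs => rw [h']
        simp
      · right; conv_rhs => rw [h']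
        simp
    rcases e with e | e
    · rw [e]; exact hpmem
    · rw [e]; exact neg_mem_iff.mpr hpmem
  have hQover := mem_primesOver_of_mem hQ hq hqQ
  haveI := hQover.2
  haveI := hQ
  have hpow := Ideal.pow_inertiaDeg q Q
  have hf : 0 < Q.inertiaDeg ℤ := by
    haveI : (span {(q : ℤ)}).IsMaximal :=
      ((span_singleton_prime (by exact_mod_cast hq.ne_zero)).mpr
        (Nat.prime_iff_prime_int.mp hq)).isMaximal (by
          rw [Ne, span_singleton_eq_bot]; exact_mod_cast hq.ne_zero)
    exact inertiaDeg_pos ..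
  have hqdvd : q ∣ m := by
    refine dvd_trans ?_ hdvd
    rw [← hpow]
    exact dvd_pow_self q hf.ne'
  exact hm q hq hqdvd Q hQover

/-- **Inert primes**: if `f` has no root modulo `p` (`p ∤ [𝓞 K : ℤ[θ]]`) then every prime above
`p` is `(p)`, so has `ClassIn H`. [cite: Marcus2018, Ch. 3, Thm. 27] -/
theorem classIn_of_no_root (hirr : Irreducible (polyQ a b c)) (hθ : aeval θ (poly a b c) = 0)
    {p : ℕ} (hp : p.Prime) (hexp : ¬ p ∣ RingOfIntegers.exponent (thetaInt hθ))
    (hnr : ∀ r : ZMod p, r ^ 3 + (a : ZMod p) * r ^ 2 + (b : ZMod p) * r + (c : ZMod p) ≠ 0)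
    (H : Subgroup (ClassGroup (𝓞 K))) :
    ∀ Q ∈ primesOver (span {(p : ℤ)}) (𝓞 K), ClassIn H Q := fun Q hQ => by
  rw [eq_span_of_no_root' hirr hθ hp hexp hQ hnr]
  exact ClassIn.span_singleton H _

/-- **One certificate step**: `P = (p, θ - r)` of norm `p`, `β = x + yθ + zθ² ∈ P`
(`p ∣ x + yr + zr²`), `|N(β)| = p · m`, and all primes above the rational primes dividing `m`
already certified `⟹ ClassIn H P`. [cite: Marcus2018, Ch. 5, Thm. 35] -/
theorem classIn_of_cert (hθ : aeval θ (poly a b c) = 0) {H : Subgroup (ClassGroup (𝓞 K))}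
    {p : ℕ} (hp : p.Prime) {r : ℤ} {P : Ideal (𝓞 K)}
    (hPeq : P = span {(p : 𝓞 K), thetaInt hθ - (r : 𝓞 K)}) (habs : absNorm P = p)
    (x y z k : ℤ) (hk : x + y * r + z * r ^ 2 = p * k) (m : ℕ) (hm0 : 0 < m)
    (hnorm : (Algebra.norm ℤ ((x : 𝓞 K) + y * thetaInt hθ + z * thetaInt hθ ^ 2)).natAbs = p * m)
    (hm : ∀ q : ℕ, q.Prime → q ∣ m → ∀ Q ∈ primesOver (span {(q : ℤ)}) (𝓞 K), ClassIn H Q) :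
    ClassIn H P := by
  have hP0 : P ≠ ⊥ := fun h => by
    rw [h, absNorm_bot] at habs; exact hp.ne_zero habs.symm
  refine ClassIn.of_mem_of_absNorm hP0 (β := (x : 𝓞 K) + y * thetaInt hθ + z * thetaInt hθ ^ 2)
    (hPeq ▸ mem_span_pair_of_eval hθ hk) hm0 (by rw [hnorm, habs]) ?_
  exact classIn_of_absNorm_dvd hm

/-! ### The `3`-torsion subgroup and order-`3` certificates -/

/-- The `3`-torsion subgroup of the class group. [folklore] -/
abbrev ker3 (K : Type*) [Field K] [NumberField K] : Subgroup (ClassGroup (𝓞 K)) :=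
  (powMonoidHom 3 : ClassGroup (𝓞 K) →* ClassGroup (𝓞 K)).ker

/-- `ClassIn (ker3 K) P ↔ [P]³ = 1` for `P ≠ ⊥`. [folklore] -/
theorem classIn_ker3_iff {P : Ideal (𝓞 K)} (hP0 : P ∈ (Ideal (𝓞 K))⁰) :
    ClassIn (ker3 K) P ↔ ClassGroup.mk0 ⟨P, hP0⟩ ^ 3 = 1 := by
  constructor
  · intro h; have := h hP0; simpa [ker3, MonoidHom.mem_ker, powMonoidHom_apply] using this
  · intro h hP0'
    simpa [ker3, MonoidHom.mem_ker, powMonoidHom_apply] using h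

/-- **A prime whose cube is principal is in `ker3`** (order certificate through
`mk0_pow_eq_one_of_forall_mem_imp_eq`): `β ∈ P` with `|N(β)| = N(P)³` lying in no other prime.
[cite: Marcus2018, Ch. 5, Thm. 35] -/
theorem classIn_ker3_of_cert {P : Ideal (𝓞 K)} (hP : P.IsPrime) (hP0 : P ≠ ⊥)
    {β : 𝓞 K} (hnorm : (Algebra.norm ℤ β).natAbs = absNorm P ^ 3)
    (honly : ∀ Q : Ideal (𝓞 K), Q.IsPrime → Q ≠ ⊥ → β ∈ Q → Q = P) : ClassIn (ker3 K) P := by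
  intro hP0'
  simpa [ker3, MonoidHom.mem_ker, powMonoidHom_apply] using
    mk0_pow_eq_one_of_forall_mem_imp_eq hP hP0 hnorm honly hP0'

/-- **Primes containing an element of prime-power norm lie above that prime**: if `β ∈ Q`,
`Q` a prime, and `|N(β)| = p^k`, then `p ∈ Q`. [folklore] -/
theorem natCast_mem_of_norm_eq_pow {Q : Ideal (𝓞 K)} (hQ : Q.IsPrime)
    {β : 𝓞 K} (hβ : β ∈ Q) {p k : ℕ}
    (hnorm : (Algebra.norm ℤ β).natAbs = p ^ k) : (p : 𝓞 K) ∈ Q := by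
  have hle : span {β} ≤ Q := (span_singleton_le_iff_mem Q).mpr hβ
  have h2 : (((Algebra.norm ℤ β).natAbs : ℕ) : 𝓞 K) ∈ Q := hle (by
    have := Ideal.absNorm_mem (span {β})
    rwa [absNorm_span_singleton] at this)
  rw [hnorm, Nat.cast_pow] at h2
  exact hQ.mem_of_pow_mem k h2

/-- **`Odd h_K` from `ker3 = ⊤`.** [folklore] -/
theorem odd_classNumber_of_ker3_eq_top (h : ker3 K = ⊤) : Odd (classNumber K) := by
  refine odd_classNumber_of_closure_eq_top (S := Set.univ) Subgroup.closure_univ fun s _ => ?_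
  have hs : s ∈ ker3 K := h ▸ Subgroup.mem_top s
  simpa [ker3, MonoidHom.mem_ker, powMonoidHom_apply] using hs

end MonicCubic

end Literature.NumberTheory.NumberFields

end
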